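import Summits.QuantumFields.YangMills.Theorems.BalabanUVNodesN21AtReadingOfRecord12
import Summits.QuantumFields.YangMills.Theorems.BalabanUVNodesN16SlotWindowReading
import HarnessLib

/-!
# YM-DAG node N21 (= NE7c) — K3′'s COMPOSITE AT THE READING OF RECORD WITH WINDOWED LETTERS, THE N16 SLOT SUPPLIED FROM NODE N05's AND N07's
# TYPED LEAVES (dag-n16-e's window recipe BY NAME): N16 ↦ `Thm4Body ∧ Prop3Body ∧ LeafH3sup` once per guarded family, N21 ↦ NODE O's term-object readings `hread`

Track A of `YM-PLAN.md` (cell `pub-ymgap`, HUMAN RULING D-0062), node **N21**; R134 fan-out seat `pub-ymgap-dag-n21-d` (s2 = BY-NAME KNIT at the record), generation 4,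
module 17.  THEOREMS ONLY: 0 `def`, 0 `sorry`, standard axioms; COUNT-NEUTRAL; `--supports` the K3′ item `SpineGivenEndpointR12` (stmt-QuantumFields-19908) as a helper.
`N`-generic, NO Theses import (restate-immune).  Imports module 11b v1.1 (`…N21AtReadingOfRecord12` §4 `spine_rec12C_of_homes₁₂_readingOfRecord₁₂_window`, at module 11a
v1.1's windowed letters `endLettersN21W`, p480188) and dag-n16-e's `…N16SlotWindowReading` (`s_N16_rRec₁₂_readingOfRecord₁₂_of_window`, their file 14; window recipe
`…N16SlotWindow.leafSlot_ofRecord_of_window`, p480052).  Restates nothing; ONE application of each BY NAME.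

WHY (dag-n16-e g4 LOCATED-3 «ε PINNED AT THE TOP OF THE TOLERANCE», closed jointly).  Module 11b §3 paired THE END's letters at `ε = Λ₁ = r` with N16's `LeafSlot` — kernel-fine,
NOT certifiably inhabitable.  With the class radius windowed (`endLettersN21W`, ε and Λ₁ the caller's) n16-e's recipe turns `LeafSlot` at RR-1's object into node N05's two
typed bodies ([Balaban1985RegularSpaces] Thm 4 ∕ Prop 3 on the univ sub-family of the ℤ⁴ gauge-field family) and node N07's `LeafH3sup`, under DISPLAYED letter inequalities
(N05's eleven-line window at `c₁'`, the averaging letter `α` under five bounds, `ε < α ≤ Λ₁∕(1770·B+1)`, `177α(B_h+B) ≤ Λ₂'`, N07's `0 ≤ b', c' ≤ α²`) which n16-e's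
`exists_window_letters_numerals` shows JOINTLY SATISFIABLE with THE END's proviso and N21's numerals.  This file is the one application: the composite `Spine ₁₂C` at the
reading of record with windowed letters where the N16 slot costs N05 ∕ N07 CONTENT (typed leaves, HYPOTHESES) and the N21 slot costs NODE O's term-object readings `hread`;
plus the A2 guard `exists_letterLines_of_leaves` (the displayed letter lines are jointly satisfiable at every family, from n16-e's witness).

HONEST FRAMING (binding).  Every K4 ∕ K5 stub (`h14 h15 h17 h18 h22` at the windowed reading, `S_N27x`, `S_N20`), the N19′ edge `h19`, N05's `Thm4Body` ∕ `Prop3Body`, N07's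
`LeafH3sup`, and `hread` (NODE O's term object: level ledgers (M1) + [dict] incl. the (0.4)∕(42) averaging transfer, live windows, threshold widths) are HYPOTHESES; the
letters are a CHOICE inside displayed windows; nothing of Bałaban's is asserted or instantiated; NE3 ∕ NE7c NOT PRINTED as two-run statements and NOT PROVED; **N21 NOT
discharged**, N16 ∕ N27 NOT discharged, K3′ NOT claimed; typed 28∕28, discharged count untouched; one finite four-torus programme at fixed `ε` — NOT ℝ⁴, NOT infinite volume,
NOT OS, NOT a mass gap, NOT Clay.  No decl below carries a cite tag.
-/

set_option autoImplicit false

noncomputable section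

open scoped BigOperators Matrix Matrix.Norms.L2Operator
open NormedSpace

namespace Summit.QuantumFields.YangMills.Theorems.N21AtReadingOfRecord12Window

open Literature.MathematicalPhysics.QuantumFieldTheory.Balaban1983to89
open Literature.MathematicalPhysics.QuantumFieldTheory.Balaban1983to89.T4Continuum (T4Family ULoop)
open B7Prop1Explicit B7Prop2Explicit
open B7Prop3Flat (c3)
open B8LeafModelZd (ZdIdx)
open B8LeafModelZd3 (zdGF3)
open T4AveragingDeficitWall (Plane)
open T4ShellMeasureLevels (LevelLedger LiveWindow)
open Summit.QuantumFields.BalabanUV.T4Continuum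
open Summit.QuantumFields.BalabanUV.T4Continuum.Spine
open BlockAverageCurrent (curConst)
open NE3RightInverseSupLetters (frameC)
open NE3.LeafIndexSockets (LeafH3sup)
open MinimalActionSandwich (IsMinimiser)
open MinimalActionRate (Regular sfClass)
open MinimalActionRefine (RegularSup)
open YMDAG.UVSplit
open Summit.QuantumFields.YangMills.BalabanUVNodes.N16Regime (radiusOfRecord radiusOfRecord_pos)
open Summit.QuantumFields.YangMills.BalabanUVNodes.N16SlotWindow (exists_window_letters_numerals)
open Summit.QuantumFields.YangMills.BalabanUVNodes.N21EndLetters (endLettersN21W endLettersN21W_b_pos endLettersN21W_b_le_half)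
open Summit.QuantumFields.YangMills.BalabanUVNodes.N16SlotWindowReading (s_N16_rRec₁₂_readingOfRecord₁₂_of_window)
open N21AtReadingOfRecord12 (spine_rec12C_of_homes₁₂_readingOfRecord₁₂_window)
open Node00 (NE3Letters₁₁ NE2Objects₁₁ Stage12Params IsDatumOfRecord₁₂C IsRecordOfRecord₁₂C datumOfRecord₁₂ ne3ConstLayerOfRecord₁₁ ne3NperOfRecord₁₁
  ne3DomOfRecord₁₁ one_le_ne3NperOfRecord₁₁)
open Node00.W1 (ReadingData)

variable {N : ℕ} [NeZero N]
  (w1 : (F : T4Family) → (θ : Stage12Params F N) → ReadingData F (Node00.MatA N) θ.τ9.M)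
  (ne2 : (F : T4Family) → Stage12Params F N → (ℕ → ℝ) → List (ULoop F) → ℕ → NE2Objects₁₁)
  (ne1 : (F : T4Family) → Stage12Params F N → (ℕ → ℝ) → List (ULoop F) → NE1pCarriers)
  (cr : SpineReading₁₂ N) (g ε Λ₁ Λ : T4Family → ℝ)
  -- N05's constants per family, the averaging letter and N07's leaf letters (dag-n16-e's window recipe)
  (len : T4Family → Site 4 → ℝ) (c₁ c₁' B₁' cP C₂ B₀β : T4Family → ℝ) (inp : T4Family → B8.B9Inputs) (α b' c' : T4Family → ℝ)

/-- **THE COMPOSITE AT THE READING OF RECORD WITH WINDOWED LETTERS, N16 FROM N05's AND N07's TYPED LEAVES.**  Module 11b §4's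
`spine_rec12C_of_homes₁₂_readingOfRecord₁₂_window` (letters `endLettersN21W F N (g F) (ε F) (Λ₁ F) (Λ F)`; N21 slot ↦ `hread`) with its binder `h16` SUPPLIED by dag-n16-e's
`s_N16_rRec₁₂_readingOfRecord₁₂_of_window` at those letters: the letter lines it asks of `ℓ` (`0 < g`, `0 < ε`, `Λ₁ ≤ r`, `0 ≤ b ≤ ε∕2`, `Cof g ≤ C`) are module 11a v1.1's faces,
so what remains DISPLAYED is N05's window data (`hlen … hα5`), `ε F < α F ≤ Λ₁ F∕(1770·B+1)`, `177·α·(B_h+B) ≤ Λ F`, N07's `0 ≤ b', c' ≤ α²`, THE END's tolerance lines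
`ε F ≤ r_F`, `0 ≤ Λ₁ F ≤ r_F`, and — the CONTENT — once per family carrying a datum of record: N05's `Thm4Body`, `Prop3Body` and N07's `LeafH3sup` (HYPOTHESES).  Conclusion
`Spine ₁₂C`.  N16 ∕ N21 ∕ N27 NOT discharged; K3′ NOT claimed. [bookkeeping] -/
theorem spine_rec12C_of_homes₁₂_readingOfRecord₁₂_window_of_leaves
    (hg : ∀ F, 0 < g F) (hε : ∀ F, 0 < ε F ∧ ε F ≤ radiusOfRecord N F.L (ne3NperOfRecord₁₁ F 0 0))
    (hΛ₁ : ∀ F, 0 ≤ Λ₁ F ∧ Λ₁ F ≤ radiusOfRecord N F.L (ne3NperOfRecord₁₁ F 0 0)) (hΛ : ∀ F, 0 < Λ F)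
    (hlen : ∀ (F : T4Family) (v : Site 4), 0 < len F v → 1 ≤ len F v) (hlen1 : ∀ (F : T4Family) (μ : Fin 4), len F (e μ) = 1)
    (hB₁' : ∀ F, 0 < B₁' F) (hBB : ∀ F : T4Family, 5 * ((4 : ℕ) : ℝ) * F.L * (inp F).B₀ ≤ B₁' F) (hc₁' : ∀ F, 0 < c₁' F)
    (hwin : ∀ (F : T4Family) (α₀ α₁ : ℝ), 0 < α₀ → 0 < α₁ → α₀ + α₁ ≤ c₁' F →
      α₀ + α₁ ≤ c₁ F ∧ C0 4 * (2 * α₀) ≤ 1 / 3 ∧ 4 * α₀ ≤ c2' 4 F.L ∧ 16 * (B₁' F * (α₀ + α₁)) ≤ 1 ∧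
      Real.exp (4 * (800 * (((4 : ℕ) : ℝ) + 1) ^ 2 * (((4 : ℕ) : ℝ) + 4)) * α₀) * (1 + 8 * (131072 * (((4 : ℕ) : ℝ) + 1) ^ 2) * (B₁' F * (α₀ + α₁))) ≤ 2 ∧
      2 * (B₁' F * (α₀ + α₁)) ≤ c3 4 F.L ∧ ((4 : ℕ) : ℝ) * F.L * α₁ ≤ 1 / 8 ∧ α₀ ≤ cP F ∧ α₁ ≤ cP F ∧ B₁' F * (α₀ + α₁) ≤ cP F ∧
      2 * (B₁' F * (α₀ + α₁)) ^ 2 + 20 * ((4 : ℕ) : ℝ) * α₀ * (B₁' F * (α₀ + α₁)) + 2 * C₂ F * (B₁' F * (α₀ + α₁)) ^ 2 ≤ α₀ + α₁)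
    (hα : ∀ F, 0 < α F) (hα1 : ∀ F, α F ≤ c₁' F / 177)
    (hα2 : ∀ F : T4Family, α F ≤ Λ₁ F / (1770 * (5 * ((4 : ℕ) : ℝ) * F.L * (inp F).B₀) + 1))
    (hα3 : ∀ F : T4Family, α F ≤ c2' 4 F.L / 2)
    (hα4 : ∀ F : T4Family, α F ≤ 1 / ((23040 * (4 : ℝ) ^ 4 * (frameC 4 F.L + 4) ^ 3 + 12) * (1 + curConst 4 F.L) + 1))
    (hα5 : ∀ F, α F ≤ 1 / 10 ^ 9) (hεα : ∀ F, ε F < α F)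
    (hΛ₂' : ∀ F : T4Family, 177 * α F * (5 * ((4 : ℕ) : ℝ) * F.L * B₀β F + 5 * ((4 : ℕ) : ℝ) * F.L * (inp F).B₀) ≤ Λ F)
    (hb' : ∀ F, 0 ≤ b' F ∧ b' F ≤ α F ^ 2) (hc' : ∀ F, 0 ≤ c' F ∧ c' F ≤ α F ^ 2)
    (hcontent : ∀ (F : T4Family), (∃ D : Datum F N, IsDatumOfRecord₁₂C F N D) →
      letI : CStarAlgebra (Matrix (Fin N) (Fin N) ℂ) := {}
      B8.Thm4Body (c₁ F) (B₁' F) (fun i : {i : ZdIdx 4 F.L // i.Ω 0 = Set.univ} => (zdGF3 (Matrix (Fin N) (Fin N) ℂ) F.L 1 (len F) i.1).toGFData) ∧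
        B8.Prop3Body (cP F) 4 (F.L : ℝ) (C₂ F) (inp F) (B₀β F)
          (fun i : {i : ZdIdx 4 F.L // i.Ω 0 = Set.univ} => (zdGF3 (Matrix (Fin N) (Fin N) ℂ) F.L 1 (len F) i.1).toGFData2) ∧
        LeafH3sup 4 F.L (ne3NperOfRecord₁₁ F 0 0) (ε F) (b' F) (c' F) (ne3DomOfRecord₁₁ F N 0 0))
  (hread : ∀ (F : T4Family) (θ : Stage12Params F N) (hP : θ.Provisos₁₂ F N), θ.Admissible F N → ∀ (g₀ : ℕ → ℝ) (os : List (ULoop F)),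
    ∃ (ε' cg : ℝ) (σA σB : Type) (SA : ℕ → Finset σA) (SB : ℕ → Finset σB) (pieceA : ℕ → ℝ → σA → (cr F θ hP g₀ os).ι → ℝ)
      (pieceB : ℕ → ℝ → σB → (cr F θ hP g₀ os).ι → ℝ) (lvlA : ℕ → σA → ℕ) (lvlB : ℕ → σB → ℕ) (DA ρA DB ρB τA τB : ℕ → ℝ) (N₁ : ℕ)
      (νbar Dbar c₂ ϑ₂ : ℝ),
      0 < ε' ∧ 0 ≤ cg ∧
      LevelLedger (cr F θ hP g₀ os).l₀ (cr F θ hP g₀ os).T (cr F θ hP g₀ os).A (cr F θ hP g₀ os).shA SA pieceA lvlA DA ρA ∧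
      LevelLedger (cr F θ hP g₀ os).l₀ (cr F θ hP g₀ os).T (cr F θ hP g₀ os).B (cr F θ hP g₀ os).shB SB pieceB lvlB DB ρB ∧
      LiveWindow SA lvlA N₁ νbar ∧ LiveWindow SB lvlB N₁ νbar ∧ (∀ j, DA j ≤ Dbar) ∧ (∀ j, DB j ≤ Dbar) ∧
      0 ≤ c₂ ∧ 0 ≤ ϑ₂ ∧ ϑ₂ < 1 ∧ (∀ j, τA j ≤ c₂ * ϑ₂ ^ j) ∧ (∀ j, τB j ≤ c₂ * ϑ₂ ^ j) ∧
      (∀ j, 1 ≤ j → ∀ x : ℝ,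
        (∀ (V UA UB : B7Prop1Explicit.Site 4 → Fin 4 → (Matrix (Fin N) (Fin N) ℂ)ˣ) (z : B7Prop1Explicit.Site 4) (μ ν : Fin 4) (t : ℝ),
          V ∈ (ne3ConstLayerOfRecord₁₁ F N (endLettersN21W F N (g F) (ε F) (Λ₁ F) (Λ F))).dom →
          IsMinimiser 4 (sfClass 4 F.L (ne3ConstLayerOfRecord₁₁ F N (endLettersN21W F N (g F) (ε F) (Λ₁ F) (Λ F))).Nper
            (ne3ConstLayerOfRecord₁₁ F N (endLettersN21W F N (g F) (ε F) (Λ₁ F) (Λ F))).ε) F.L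
            (ne3ConstLayerOfRecord₁₁ F N (endLettersN21W F N (g F) (ε F) (Λ₁ F) (Λ F))).Nper j V UA →
          IsMinimiser 4 (sfClass 4 F.L (ne3ConstLayerOfRecord₁₁ F N (endLettersN21W F N (g F) (ε F) (Λ₁ F) (Λ F))).Nper
            (ne3ConstLayerOfRecord₁₁ F N (endLettersN21W F N (g F) (ε F) (Λ₁ F) (Λ F))).ε) F.L
            (ne3ConstLayerOfRecord₁₁ F N (endLettersN21W F N (g F) (ε F) (Λ₁ F) (Λ F))).Nper (j + 1) V UB →
          Regular 4 F.L (ne3ConstLayerOfRecord₁₁ F N (endLettersN21W F N (g F) (ε F) (Λ₁ F) (Λ F))).Nper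
            (ne3ConstLayerOfRecord₁₁ F N (endLettersN21W F N (g F) (ε F) (Λ₁ F) (Λ F))).b
            (ne3ConstLayerOfRecord₁₁ F N (endLettersN21W F N (g F) (ε F) (Λ₁ F) (Λ F))).g (j + 1) UB →
          ε' * ((F.L : ℝ)⁻¹) ^ (2 * j) ≤ t →
          |‖((hol UA z (plaqWord μ ν) : (Matrix (Fin N) (Fin N) ℂ)ˣ) : Matrix (Fin N) (Fin N) ℂ) - 1‖
              - ‖((hol (rescale F.L (bavg F.L UB)) z (plaqWord μ ν) : (Matrix (Fin N) (Fin N) ℂ)ˣ) : Matrix (Fin N) (Fin N) ℂ) - 1‖| / t ≤ x) →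
        ρA j ≤ x + τA j) ∧
      (∀ j, 1 ≤ j → ∀ x : ℝ,
        (∀ (V UA UB : B7Prop1Explicit.Site 4 → Fin 4 → (Matrix (Fin N) (Fin N) ℂ)ˣ) (z : B7Prop1Explicit.Site 4) (π : Plane 4)
          (r₀ : Fin 4 → Fin F.L) (i₀ j₀ : ℕ) (t : ℝ),
          V ∈ (ne3ConstLayerOfRecord₁₁ F N (endLettersN21W F N (g F) (ε F) (Λ₁ F) (Λ F))).dom →
          IsMinimiser 4 (sfClass 4 F.L (ne3ConstLayerOfRecord₁₁ F N (endLettersN21W F N (g F) (ε F) (Λ₁ F) (Λ F))).Nper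
            (ne3ConstLayerOfRecord₁₁ F N (endLettersN21W F N (g F) (ε F) (Λ₁ F) (Λ F))).ε) F.L
            (ne3ConstLayerOfRecord₁₁ F N (endLettersN21W F N (g F) (ε F) (Λ₁ F) (Λ F))).Nper j V UA →
          IsMinimiser 4 (sfClass 4 F.L (ne3ConstLayerOfRecord₁₁ F N (endLettersN21W F N (g F) (ε F) (Λ₁ F) (Λ F))).Nper
            (ne3ConstLayerOfRecord₁₁ F N (endLettersN21W F N (g F) (ε F) (Λ₁ F) (Λ F))).ε) F.L
            (ne3ConstLayerOfRecord₁₁ F N (endLettersN21W F N (g F) (ε F) (Λ₁ F) (Λ F))).Nper (j + 1) V UB →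
          Regular 4 F.L (ne3ConstLayerOfRecord₁₁ F N (endLettersN21W F N (g F) (ε F) (Λ₁ F) (Λ F))).Nper
            (ne3ConstLayerOfRecord₁₁ F N (endLettersN21W F N (g F) (ε F) (Λ₁ F) (Λ F))).b
            (ne3ConstLayerOfRecord₁₁ F N (endLettersN21W F N (g F) (ε F) (Λ₁ F) (Λ F))).g (j + 1) UB →
          RegularSup 4 F.L (ne3ConstLayerOfRecord₁₁ F N (endLettersN21W F N (g F) (ε F) (Λ₁ F) (Λ F))).Nper
            (ne3ConstLayerOfRecord₁₁ F N (endLettersN21W F N (g F) (ε F) (Λ₁ F) (Λ F))).b cg (j + 1) UB → i₀ < F.L → j₀ < F.L →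
          ε' * ((F.L : ℝ)⁻¹) ^ (2 * j) ≤ t →
          |‖((hol UA z (plaqWord π.1.1 π.1.2) : (Matrix (Fin N) (Fin N) ℂ)ˣ) : Matrix (Fin N) (Fin N) ℂ) - 1‖
              - (F.L : ℝ) ^ 2 * ‖((hol UB ((F.L : ℤ) • z + boxVec F.L r₀ + (i₀ : ℤ) • e π.1.1 + (j₀ : ℤ) • e π.1.2)
                  (plaqWord π.1.1 π.1.2) : (Matrix (Fin N) (Fin N) ℂ)ˣ) : Matrix (Fin N) (Fin N) ℂ) - 1‖| / t ≤ x) →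
        ρB j ≤ x + τB j))
  (h14 : S_N14 (RRec₁₂ (readingOfRecord₁₂ w1 (fun F => endLettersN21W F N (g F) (ε F) (Λ₁ F) (Λ F)) ne2 ne1)))
  (h15 : S_N15 (RRec₁₂ (readingOfRecord₁₂ w1 (fun F => endLettersN21W F N (g F) (ε F) (Λ₁ F) (Λ F)) ne2 ne1)))
  (h17 : S_N17 (RRec₁₂ (readingOfRecord₁₂ w1 (fun F => endLettersN21W F N (g F) (ε F) (Λ₁ F) (Λ F)) ne2 ne1)))
  (h18 : S_N18 (RRec₁₂ (readingOfRecord₁₂ w1 (fun F => endLettersN21W F N (g F) (ε F) (Λ₁ F) (Λ F)) ne2 ne1)))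
  (h22 : S_N22 (RRec₁₂ (readingOfRecord₁₂ w1 (fun F => endLettersN21W F N (g F) (ε F) (Λ₁ F) (Λ F)) ne2 ne1)))
  (hx' : S_N27x (fun F D w => IsRecordOfRecord₁₂C F N D w) (SRec₁₂ cr)) (h20 : S_N20 (SRec₁₂ cr))
  (h19 : ∀ (F : T4Family) (θ : Stage12Params F N) (hP : θ.Provisos₁₂ F N), θ.Admissible F N → ∀ (g₀ : ℕ → ℝ) (os : List (ULoop F))
    (h : IsDatumOfRecord₁₂C F N (datumOfRecord₁₂ F N θ hP)) (k : ℕ),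
    RatesAt (datumOfRecord₁₂ F N θ hP)
        (rateCarriersOfRecord₁₂ (readingOfRecord₁₂ w1 (fun F => endLettersN21W F N (g F) (ε F) (Λ₁ F) (Λ F)) ne2 ne1) F h.params h.provisos g₀ os k) →
      letI := (cr F θ hP g₀ os).dec
      ∃ δ : ℕ → ℝ, NE7.Core (cr F θ hP g₀ os).l₀ (cr F θ hP g₀ os).vol (cr F θ hP g₀ os).T (cr F θ hP g₀ os).Bad
        (fun K t τ => (cr F θ hP g₀ os).A K t τ - (cr F θ hP g₀ os).shA K t τ) (fun K t τ => (cr F θ hP g₀ os).B K t τ - (cr F θ hP g₀ os).shB K t τ) δ ∧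
        Summable δ)
 :
    Spine (N := N) fun F D w => IsRecordOfRecord₁₂C F N D w :=
  spine_rec12C_of_homes₁₂_readingOfRecord₁₂_window w1 ne2 ne1 cr g ε Λ₁ Λ hg hε hΛ₁ hΛ hread h14 h15 h17 h18 h22 hx' h20 h19
    (s_N16_rRec₁₂_readingOfRecord₁₂_of_window w1 ne2 ne1 (fun F => endLettersN21W F N (g F) (ε F) (Λ₁ F) (Λ F)) len c₁ c₁' B₁' cP C₂ B₀β inp α b' c'
      hlen hlen1 hB₁' hBB hc₁' hwin hα hα1 hα2 hα3 hα4 hα5 hg (fun F => (hε F).1) hεα (fun F => (hΛ₁ F).2)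
      (fun F => ⟨(endLettersN21W_b_pos F N (g F) (Λ₁ F) (Λ F) (hε F).1).le, endLettersN21W_b_le_half F N (g F) (ε F) (Λ₁ F) (Λ F)⟩)
      (fun _ => le_rfl) hΛ₂' hb' hc' hcontent)

/-! ## The displayed letter lines are jointly satisfiable, family by family (A2 guard; n16-e's `exists_window_letters_numerals` BY NAME) -/

/-- **THE LETTER LINES OF `…_window_of_leaves` ARE JOINTLY SATISFIABLE** at every family (given N05's window constant `c₁' > 0`, its inputs `inp`, the Hölder constant `B₀β`
and a coupling letter `g > 0`): there are `ε, Λ₁, Λ, α` with `0 < ε ≤ r`, `0 ≤ Λ₁ ≤ r`, `0 < Λ`, the five `α`-bounds, `ε < α`, `α ≤ Λ₁∕(1770·B+1)` and `177·α·(B_h+B) ≤ Λ`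
— read off dag-n16-e's witness `exists_window_letters_numerals` (`Λ₁ = r`, `ε < α ≤ r∕(1770·B+1) ≤ r`); N07's letters may be taken `b' = c' = 0`.  So, unlike at the pinned
`ε = r` (their `radiusOfRecord_lt_of_leafSlot_endLettersN21`), the composite's letter hypotheses exclude nothing; what it ASKS is the content. [folklore] -/
theorem exists_letterLines_of_leaves (F : T4Family) {c₁' : ℝ} (hc₁' : 0 < c₁') (inp : B8.B9Inputs) (B₀β : ℝ) {g : ℝ} (hg : 0 < g) :
    ∃ ε Λ₁ Λ α : ℝ,
      0 < ε ∧ ε ≤ radiusOfRecord N F.L (ne3NperOfRecord₁₁ F 0 0) ∧ 0 ≤ Λ₁ ∧ Λ₁ ≤ radiusOfRecord N F.L (ne3NperOfRecord₁₁ F 0 0) ∧ 0 < Λ ∧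
      0 < α ∧ α ≤ c₁' / 177 ∧ α ≤ Λ₁ / (1770 * (5 * ((4 : ℕ) : ℝ) * F.L * inp.B₀) + 1) ∧ α ≤ c2' 4 F.L / 2 ∧
      α ≤ 1 / ((23040 * (4 : ℝ) ^ 4 * (frameC 4 F.L + 4) ^ 3 + 12) * (1 + curConst 4 F.L) + 1) ∧ α ≤ 1 / 10 ^ 9 ∧
      ε < α ∧ 177 * α * (5 * ((4 : ℕ) : ℝ) * F.L * B₀β + 5 * ((4 : ℕ) : ℝ) * F.L * inp.B₀) ≤ Λ := by
  obtain ⟨α, ℓ, hα, h1, h2, h3, h4, h5, -, hε0, hεα, hΛ₁, -, -, -, hΛ₂', hΛpos, -, -⟩ :=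
    exists_window_letters_numerals (N := N) F hc₁' inp B₀β hg
  have hr : 0 < radiusOfRecord N F.L (ne3NperOfRecord₁₁ F 0 0) :=
    radiusOfRecord_pos (HistoryFlow.two_le_L F) (one_le_ne3NperOfRecord₁₁ F 0 0)
  have hB : 0 ≤ 1770 * (5 * ((4 : ℕ) : ℝ) * F.L * inp.B₀) := by
    have := inp.B₀_pos; positivity
  -- `α ≤ r∕(1770·B+1) ≤ r`
  have hαr : α ≤ radiusOfRecord N F.L (ne3NperOfRecord₁₁ F 0 0) := by
    rw [hΛ₁] at h2
    exact h2.trans (div_le_self hr.le (by linarith))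
  exact ⟨ℓ.ε, ℓ.Λ₁, ℓ.Λ₂', α, hε0, (hεα.le.trans hαr), hΛ₁ ▸ hr.le, hΛ₁ ▸ le_rfl, hΛpos, hα, h1, h2, h3, h4, h5, hεα, hΛ₂'⟩

end Summit.QuantumFields.YangMills.Theorems.N21AtReadingOfRecord12Window

end
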